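import Summits.QuantumFields.BalabanUV.Beta.GAN24.FaceWWordSummable

/-!
# GAN24 ∕ PART VI ∕ T6-STEP SUPPLIER — Part 50b: the leg-symmetrised W face word of the dressed step vanishes

[folklore] bookkeeping of the crux team's leaf 02 (road-P2's forcing frame): hypothesis `hW0` of Part 49
`ForcingFacePairFormGlue.pairFormLS_of_threeWords` at `Ww :=` the W face word of the dressed step.  With
`X̃ = unitK sf sm (coDressKBmAt (toSite r) Lc (KInvStep Lc j))`, `W̃ = W2SymOfK X̃ Lc S M 0 M₂` (first tables `S`, `M` with parity-odd rows,
mixed table `M₂` a local field–multiplier table with the block translation law), coarse bond period `P` and any leg modulus `NL ∣ Lc·P`: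
every bond term of the W face word splits into its two mixed and two response pieces (Part 50a `tsum_facePair_W2SymOfK_zero₂`, all four
free-bond series converge by `summable_pairWord_far`); the two mixed face words vanish (`FaceWWordLetters.tsum_faceBond_mixWord_eq_zero`,
`sum_box_tsum_mixWord_swap_eq_zero`) and the response words are odd under the exchange of the two legs
(`FaceWWordLetters.resp_facePair_swap`), so `Ww(κ,κ′;κ₁,κ₂) + Ww(κ′,κ;κ₁,κ₂) + (Ww(κ,κ′;κ₂,κ₁) + Ww(κ′,κ;κ₂,κ₁)) = 0`.

HONEST: NOT IN PRINT; nothing of `(C)_{≥1}` ∕ `hBF` is discharged here; NOT D1, NOT `BetaPertH`, NOT continuum, NOT Clay.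
-/

noncomputable section

open Finset
open scoped BigOperators
open Literature.MathematicalPhysics.QuantumFieldTheory
open Literature.MathematicalPhysics.QuantumFieldTheory.Balaban1983to89
open Literature.MathematicalPhysics.QuantumFieldTheory.Balaban1983to89.Beta
open B12Sec2to5 (l1 l1_nonneg)
open ExpKernelCalculus (Site MKer Decays BiLoc VertexFamily shiftK l1_sub_symm Zl Zl_pos Zl_nonneg)
open OneStepResolventKernel (Fib LocStencil)
open AffineAveraging (box toSite)
open OneStepKernelFamily (KInvStep decays_KInvStep)
open SecondOrderResponse (dM K2OfK mixOfK W2SymOfK LocStencilFM)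
open BalabanStepJets (locStencil_mono)
open BalabanStepW2 (vertexFamily_mono')
open Summit.QuantumFields.BalabanUV.Beta.TameKernelCalculus (trK)
open Summit.QuantumFields.BalabanUV.Beta.BorderedHessian (sgnK)
open Summit.QuantumFields.BalabanUV.Beta.AxialDressingRooted (coDressKBmAt decays_coDressKBmAt)
open Summit.QuantumFields.BalabanUV.Beta.HessKerDressedUnits (unitK decays_unitK)
open Summit.QuantumFields.BalabanUV.Beta.GAN24.FaceWWordLetters (locStencilFM_mono resp_facePair_swap tsum_faceBond_mixWord_eq_zero
  sum_box_tsum_mixWord_swap_eq_zero)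
open Summit.QuantumFields.BalabanUV.Beta.GAN24.FaceWWordSummable (biLoc_resp_far biLoc_resp_far_swap biLoc_mixOfK_far' biLoc_mixOfK_far_swap
  summable_pairWord_far tsum_facePair_W2SymOfK_zero₂)

namespace Summit.QuantumFields.BalabanUV.Beta.GAN24.FaceWWordVanishing

variable {d : ℕ}

/-! ## §4 The leg-symmetrised W face word of the dressed step vanishes -/

section Dressed

variable {Lc : ℕ} [NeZero Lc] {r : Fin (d + 1) → ℕ}

/-- [folklore] **`hW0` OF PART 49 FOR THE DRESSED STEP** (table scale `Lc`, coarse bond period `P`, any leg modulus dividing `Lc·P`): with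
`X̃ = unitK sf sm (coDressKBmAt (toSite r) Lc (KInvStep Lc j))` and `W̃ = W2SymOfK X̃ Lc S M 0 M₂`, the W face word
`Ww(μ,ν;α,β) := Σ_{r′ ∈ box P} Σ'_{u′} [r′_μ ≡ −1][u′_ν ≡ −1]_P · Σ'_{(x,z)} [x_α ≡ −1][z_β ≡ −1]_{NL} · W̃ μ r′ ν u′ x z (inl α)(inl β)` satisfies
`Ww(κ,κ′;κ₁,κ₂) + Ww(κ′,κ;κ₁,κ₂) + (Ww(κ,κ′;κ₂,κ₁) + Ww(κ′,κ;κ₂,κ₁)) = 0`: the two mixed face words vanish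
(`tsum_faceBond_mixWord_eq_zero`, `sum_box_tsum_mixWord_swap_eq_zero`) and the response words are odd under the leg exchange
(`resp_facePair_swap`, first tables with parity-odd rows). -/
theorem faceWWord_LS_eq_zero (hLc : 1 ≤ Lc) (hr : r ∈ box (d + 1) Lc) (sf sm : ℝ) (j : ℕ) {P : ℕ} [NeZero P]
    {S M : Fin (d + 1) → (Fin (d + 1) → ℤ) → MKer (d + 1) (Fib d)} {Cs δs CM δM : ℝ}
    (hS : LocStencil S Cs δs) (hδs : 0 < δs) (hM : VertexFamily M Lc CM δM) (hδM : 0 < δM)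
    (hSrow : ∀ κ u, trK (S κ u) = -sgnK (S κ u)) (hMrow : ∀ ρ w, trK (M ρ w) = -sgnK (M ρ w))
    {M₂ : Fin (d + 1) → Site (d + 1) → Fin (d + 1) → Site (d + 1) → MKer (d + 1) (Fib d)} {C₂ δ₂ : ℝ} (hM₂ : LocStencilFM Lc M₂ C₂ δ₂) (hδ₂ : 0 < δ₂)
    (hM₂t : ∀ (κ : Fin (d + 1)) (u : Site (d + 1)) (ρ : Fin (d + 1)) (w t : Site (d + 1)), M₂ κ (u + (Lc : ℤ) • t) ρ (w + t) = shiftK (-((Lc : ℤ) • t)) (M₂ κ u ρ w))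
    (NL : ℤ) (hNL : NL ∣ (Lc : ℤ) * (P : ℤ)) :
    ∀ κ κ' κ₁ κ₂ : Fin (d + 1),
      (fun μ ν α β : Fin (d + 1) => ∑ r' ∈ box (d + 1) P, ∑' u' : Site (d + 1),
          (if toSite r' μ % (P : ℤ) = (P : ℤ) - 1 then (1 : ℝ) else 0) * (if u' ν % (P : ℤ) = (P : ℤ) - 1 then (1 : ℝ) else 0) *
            ∑' yw : Site (d + 1) × Site (d + 1), (if yw.1 α % NL = NL - 1 then (1 : ℝ) else 0) * (if yw.2 β % NL = NL - 1 then (1 : ℝ) else 0) *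
              W2SymOfK (unitK sf sm (coDressKBmAt (toSite r) Lc (KInvStep (d := d) Lc j))) Lc S M 0 M₂ μ (toSite r') ν u' yw.1 yw.2
                (Sum.inl α) (Sum.inl β)) κ κ' κ₁ κ₂
      + (fun μ ν α β : Fin (d + 1) => ∑ r' ∈ box (d + 1) P, ∑' u' : Site (d + 1),
          (if toSite r' μ % (P : ℤ) = (P : ℤ) - 1 then (1 : ℝ) else 0) * (if u' ν % (P : ℤ) = (P : ℤ) - 1 then (1 : ℝ) else 0) *
            ∑' yw : Site (d + 1) × Site (d + 1), (if yw.1 α % NL = NL - 1 then (1 : ℝ) else 0) * (if yw.2 β % NL = NL - 1 then (1 : ℝ) else 0) *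
              W2SymOfK (unitK sf sm (coDressKBmAt (toSite r) Lc (KInvStep (d := d) Lc j))) Lc S M 0 M₂ μ (toSite r') ν u' yw.1 yw.2
                (Sum.inl α) (Sum.inl β)) κ' κ κ₁ κ₂
      + ((fun μ ν α β : Fin (d + 1) => ∑ r' ∈ box (d + 1) P, ∑' u' : Site (d + 1),
          (if toSite r' μ % (P : ℤ) = (P : ℤ) - 1 then (1 : ℝ) else 0) * (if u' ν % (P : ℤ) = (P : ℤ) - 1 then (1 : ℝ) else 0) *
            ∑' yw : Site (d + 1) × Site (d + 1), (if yw.1 α % NL = NL - 1 then (1 : ℝ) else 0) * (if yw.2 β % NL = NL - 1 then (1 : ℝ) else 0) *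
              W2SymOfK (unitK sf sm (coDressKBmAt (toSite r) Lc (KInvStep (d := d) Lc j))) Lc S M 0 M₂ μ (toSite r') ν u' yw.1 yw.2
                (Sum.inl α) (Sum.inl β)) κ κ' κ₂ κ₁
      + (fun μ ν α β : Fin (d + 1) => ∑ r' ∈ box (d + 1) P, ∑' u' : Site (d + 1),
          (if toSite r' μ % (P : ℤ) = (P : ℤ) - 1 then (1 : ℝ) else 0) * (if u' ν % (P : ℤ) = (P : ℤ) - 1 then (1 : ℝ) else 0) *
            ∑' yw : Site (d + 1) × Site (d + 1), (if yw.1 α % NL = NL - 1 then (1 : ℝ) else 0) * (if yw.2 β % NL = NL - 1 then (1 : ℝ) else 0) *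
              W2SymOfK (unitK sf sm (coDressKBmAt (toSite r) Lc (KInvStep (d := d) Lc j))) Lc S M 0 M₂ μ (toSite r') ν u' yw.1 yw.2
                (Sum.inl α) (Sum.inl β)) κ' κ κ₂ κ₁) = 0 := by
  classical
  -- common rate and the decay of the dressed kernel
  obtain ⟨δ, C', hδ, hC', hK'⟩ := decays_coDressKBmAt hLc hr (decays_KInvStep (d := d) (Lc := Lc) j)
  have hKu := decays_unitK (sf := sf) (sm := sm) hK'
  have hCK0 : 0 ≤ max |sf| |sm| * C' * max |sf| |sm| := hKu.nonneg (Sum.inl 0)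
  have hCs : 0 ≤ Cs := (hS 0 0).nonneg (Sum.inl 0)
  have hCM : 0 ≤ CM := (hM 0 0).nonneg (Sum.inl 0)
  have hC₂ : 0 ≤ C₂ := hM₂.nonneg
  set m₀ : ℝ := min (min (min δ δs) δM) δ₂ with hm₀
  have hm0 : 0 < m₀ := lt_min (lt_min (lt_min hδ hδs) hδM) hδ₂
  have hKm : Decays (unitK sf sm (coDressKBmAt (toSite r) Lc (KInvStep (d := d) Lc j))) (max |sf| |sm| * C' * max |sf| |sm|) m₀ :=
    OneStepResolventKernel.decays_mono hKu hCK0 le_rfl ((min_le_left _ _).trans ((min_le_left _ _).trans (min_le_left _ _)))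
  have hSm : LocStencil S Cs m₀ := locStencil_mono hS hCs ((min_le_left _ _).trans ((min_le_left _ _).trans (min_le_right _ _)))
  have hMm : VertexFamily M Lc CM m₀ := vertexFamily_mono' hM hCM ((min_le_left _ _).trans (min_le_right _ _))
  have hM₂m : LocStencilFM Lc M₂ C₂ m₀ := locStencilFM_mono hM₂ hC₂ (min_le_right _ _)
  -- the bond masks
  have hχ : ∀ s : ℤ, |(fun s : ℤ => if s % (P : ℤ) = (P : ℤ) - 1 then (1 : ℝ) else 0) s| ≤ 1 := by
    intro s; simp only; split_ifs <;> simp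
  have hχP : ∀ (κ : Fin (d + 1)) (u s : Site (d + 1)),
      (fun s : ℤ => if s % (P : ℤ) = (P : ℤ) - 1 then (1 : ℝ) else 0) ((u + (P : ℤ) • s) κ)
        = (fun s : ℤ => if s % (P : ℤ) = (P : ℤ) - 1 then (1 : ℝ) else 0) (u κ) := by
    intro κ u s
    simp only [Pi.add_apply, Pi.smul_apply, smul_eq_mul, Int.add_mul_emod_self_left]
  -- the leg masks are `Lc·P`-periodic
  have hmN : ∀ (α β : Fin (d + 1)) (y₁ w₀ s : Site (d + 1)),
      (fun yw : Site (d + 1) × Site (d + 1) => (if yw.1 α % NL = NL - 1 then (1 : ℝ) else 0) * (if yw.2 β % NL = NL - 1 then (1 : ℝ) else 0))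
          (y₁ + (Lc : ℤ) • ((P : ℤ) • s), w₀ + (Lc : ℤ) • ((P : ℤ) • s))
        = (fun yw : Site (d + 1) × Site (d + 1) => (if yw.1 α % NL = NL - 1 then (1 : ℝ) else 0) * (if yw.2 β % NL = NL - 1 then (1 : ℝ) else 0))
          (y₁, w₀) := by
    intro α β y₁ w₀ s
    obtain ⟨q, hq⟩ := hNL
    have e : ∀ (v : Site (d + 1)) (γ : Fin (d + 1)), (v + (Lc : ℤ) • ((P : ℤ) • s)) γ % NL = v γ % NL := by
      intro v γ
      have h1 : (v + (Lc : ℤ) • ((P : ℤ) • s)) γ = v γ + NL * (q * s γ) := by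
        simp only [Pi.add_apply, Pi.smul_apply, smul_eq_mul]
        rw [← mul_assoc, hq, mul_assoc]
      rw [h1, Int.add_mul_emod_self_left]
    simp only [e]
  have hmb : ∀ (α β : Fin (d + 1)) (yw : Site (d + 1) × Site (d + 1)),
      |(fun yw : Site (d + 1) × Site (d + 1) => (if yw.1 α % NL = NL - 1 then (1 : ℝ) else 0) * (if yw.2 β % NL = NL - 1 then (1 : ℝ) else 0)) yw| ≤ 1 := by
    intro α β yw; simp only; split_ifs <;> simp
  -- the W face word = response part (the two mixed face words vanish)
  have hWw : ∀ μ ν α β : Fin (d + 1),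
      (∑ r' ∈ box (d + 1) P, ∑' u' : Site (d + 1),
          (if toSite r' μ % (P : ℤ) = (P : ℤ) - 1 then (1 : ℝ) else 0) * (if u' ν % (P : ℤ) = (P : ℤ) - 1 then (1 : ℝ) else 0) *
            ∑' yw : Site (d + 1) × Site (d + 1), (if yw.1 α % NL = NL - 1 then (1 : ℝ) else 0) * (if yw.2 β % NL = NL - 1 then (1 : ℝ) else 0) *
              W2SymOfK (unitK sf sm (coDressKBmAt (toSite r) Lc (KInvStep (d := d) Lc j))) Lc S M 0 M₂ μ (toSite r') ν u' yw.1 yw.2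
                (Sum.inl α) (Sum.inl β))
        = (1 / 2 : ℝ) * ∑ r' ∈ box (d + 1) P, ∑' u' : Site (d + 1),
          (if toSite r' μ % (P : ℤ) = (P : ℤ) - 1 then (1 : ℝ) else 0) * (if u' ν % (P : ℤ) = (P : ℤ) - 1 then (1 : ℝ) else 0) *
            ((∑' yw : Site (d + 1) × Site (d + 1), (if yw.1 α % NL = NL - 1 then (1 : ℝ) else 0) * (if yw.2 β % NL = NL - 1 then (1 : ℝ) else 0) *
                dM (K2OfK (unitK sf sm (coDressKBmAt (toSite r) Lc (KInvStep (d := d) Lc j))) Lc S M ν u') Lc S M μ (toSite r') yw.1 yw.2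
                  (Sum.inl α) (Sum.inl β))
             + (∑' yw : Site (d + 1) × Site (d + 1), (if yw.1 α % NL = NL - 1 then (1 : ℝ) else 0) * (if yw.2 β % NL = NL - 1 then (1 : ℝ) else 0) *
                dM (K2OfK (unitK sf sm (coDressKBmAt (toSite r) Lc (KInvStep (d := d) Lc j))) Lc S M μ (toSite r')) Lc S M ν u' yw.1 yw.2
                  (Sum.inl α) (Sum.inl β))) := by
    intro μ ν α β
    -- abbreviations for the four bond-level words
    have hm24 : 0 < m₀ / 2 / 4 := by positivity
    have hm8 : 0 < m₀ / 8 := by positivity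
    have hm82 : 0 < m₀ / 8 / 2 := by positivity
    have s1 : ∀ r' : Fin (d + 1) → ℕ, Summable fun u' : Site (d + 1) => (if u' ν % (P : ℤ) = (P : ℤ) - 1 then (1 : ℝ) else 0) *
        ∑' yw : Site (d + 1) × Site (d + 1), (if yw.1 α % NL = NL - 1 then (1 : ℝ) else 0) * (if yw.2 β % NL = NL - 1 then (1 : ℝ) else 0) *
          mixOfK (unitK sf sm (coDressKBmAt (toSite r) Lc (KInvStep (d := d) Lc j))) Lc M₂ μ (toSite r') ν u' yw.1 yw.2 (Sum.inl α) (Sum.inl β) :=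
      fun r' => summable_pairWord_far (N := Lc) hLc hm24 hm24 (toSite r')
        (fun u' => biLoc_mixOfK_far' (N := Lc) hKm hCK0 hM₂m hm0 μ (toSite r') ν u') (fun u' => if u' ν % (P : ℤ) = (P : ℤ) - 1 then (1 : ℝ) else 0)
        (fun u' => hχ (u' ν)) NL α β (Sum.inl α) (Sum.inl β)
    have s2 : ∀ r' : Fin (d + 1) → ℕ, Summable fun u' : Site (d + 1) => (if u' ν % (P : ℤ) = (P : ℤ) - 1 then (1 : ℝ) else 0) *
        ∑' yw : Site (d + 1) × Site (d + 1), (if yw.1 α % NL = NL - 1 then (1 : ℝ) else 0) * (if yw.2 β % NL = NL - 1 then (1 : ℝ) else 0) *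
          mixOfK (unitK sf sm (coDressKBmAt (toSite r) Lc (KInvStep (d := d) Lc j))) Lc M₂ ν u' μ (toSite r') yw.1 yw.2 (Sum.inl α) (Sum.inl β) :=
      fun r' => summable_pairWord_far (N := Lc) hLc hm24 hm24 (toSite r')
        (fun u' => biLoc_mixOfK_far_swap (N := Lc) hKm hCK0 hM₂m hm0 μ (toSite r') ν u') (fun u' => if u' ν % (P : ℤ) = (P : ℤ) - 1 then (1 : ℝ) else 0)
        (fun u' => hχ (u' ν)) NL α β (Sum.inl α) (Sum.inl β)
    have s3 : ∀ r' : Fin (d + 1) → ℕ, Summable fun u' : Site (d + 1) => (if u' ν % (P : ℤ) = (P : ℤ) - 1 then (1 : ℝ) else 0) *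
        ∑' yw : Site (d + 1) × Site (d + 1), (if yw.1 α % NL = NL - 1 then (1 : ℝ) else 0) * (if yw.2 β % NL = NL - 1 then (1 : ℝ) else 0) *
          dM (K2OfK (unitK sf sm (coDressKBmAt (toSite r) Lc (KInvStep (d := d) Lc j))) Lc S M ν u') Lc S M μ (toSite r') yw.1 yw.2
            (Sum.inl α) (Sum.inl β) :=
      fun r' => summable_pairWord_far (N := Lc) hLc hm82 hm8 (toSite r')
        (fun u' => biLoc_resp_far (N := Lc) hKm hCK0 hm0 hSm hMm μ (toSite r') ν u') (fun u' => if u' ν % (P : ℤ) = (P : ℤ) - 1 then (1 : ℝ) else 0)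
        (fun u' => hχ (u' ν)) NL α β (Sum.inl α) (Sum.inl β)
    have s4 : ∀ r' : Fin (d + 1) → ℕ, Summable fun u' : Site (d + 1) => (if u' ν % (P : ℤ) = (P : ℤ) - 1 then (1 : ℝ) else 0) *
        ∑' yw : Site (d + 1) × Site (d + 1), (if yw.1 α % NL = NL - 1 then (1 : ℝ) else 0) * (if yw.2 β % NL = NL - 1 then (1 : ℝ) else 0) *
          dM (K2OfK (unitK sf sm (coDressKBmAt (toSite r) Lc (KInvStep (d := d) Lc j))) Lc S M μ (toSite r')) Lc S M ν u' yw.1 yw.2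
            (Sum.inl α) (Sum.inl β) :=
      fun r' => summable_pairWord_far (N := Lc) hLc hm82 hm8 (toSite r')
        (fun u' => biLoc_resp_far_swap (N := Lc) hKm hCK0 hm0 hSm hMm μ (toSite r') ν u') (fun u' => if u' ν % (P : ℤ) = (P : ℤ) - 1 then (1 : ℝ) else 0)
        (fun u' => hχ (u' ν)) NL α β (Sum.inl α) (Sum.inl β)
    -- split every bond term into the four pieces
    have hsplit : ∀ r' : Fin (d + 1) → ℕ,
        (∑' u' : Site (d + 1),
          (if toSite r' μ % (P : ℤ) = (P : ℤ) - 1 then (1 : ℝ) else 0) * (if u' ν % (P : ℤ) = (P : ℤ) - 1 then (1 : ℝ) else 0) *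
            ∑' yw : Site (d + 1) × Site (d + 1), (if yw.1 α % NL = NL - 1 then (1 : ℝ) else 0) * (if yw.2 β % NL = NL - 1 then (1 : ℝ) else 0) *
              W2SymOfK (unitK sf sm (coDressKBmAt (toSite r) Lc (KInvStep (d := d) Lc j))) Lc S M 0 M₂ μ (toSite r') ν u' yw.1 yw.2
                (Sum.inl α) (Sum.inl β))
        = (if toSite r' μ % (P : ℤ) = (P : ℤ) - 1 then (1 : ℝ) else 0) *
            ((∑' u' : Site (d + 1), (if u' ν % (P : ℤ) = (P : ℤ) - 1 then (1 : ℝ) else 0) *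
                ∑' yw : Site (d + 1) × Site (d + 1), (if yw.1 α % NL = NL - 1 then (1 : ℝ) else 0) * (if yw.2 β % NL = NL - 1 then (1 : ℝ) else 0) *
                  mixOfK (unitK sf sm (coDressKBmAt (toSite r) Lc (KInvStep (d := d) Lc j))) Lc M₂ μ (toSite r') ν u' yw.1 yw.2 (Sum.inl α) (Sum.inl β))
             + (∑' u' : Site (d + 1), (if u' ν % (P : ℤ) = (P : ℤ) - 1 then (1 : ℝ) else 0) *
                ∑' yw : Site (d + 1) × Site (d + 1), (if yw.1 α % NL = NL - 1 then (1 : ℝ) else 0) * (if yw.2 β % NL = NL - 1 then (1 : ℝ) else 0) *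
                  mixOfK (unitK sf sm (coDressKBmAt (toSite r) Lc (KInvStep (d := d) Lc j))) Lc M₂ ν u' μ (toSite r') yw.1 yw.2 (Sum.inl α) (Sum.inl β))
             + (1 / 2 : ℝ) * ((∑' u' : Site (d + 1), (if u' ν % (P : ℤ) = (P : ℤ) - 1 then (1 : ℝ) else 0) *
                  ∑' yw : Site (d + 1) × Site (d + 1), (if yw.1 α % NL = NL - 1 then (1 : ℝ) else 0) * (if yw.2 β % NL = NL - 1 then (1 : ℝ) else 0) *
                    dM (K2OfK (unitK sf sm (coDressKBmAt (toSite r) Lc (KInvStep (d := d) Lc j))) Lc S M ν u') Lc S M μ (toSite r') yw.1 yw.2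
                      (Sum.inl α) (Sum.inl β))
               + (∑' u' : Site (d + 1), (if u' ν % (P : ℤ) = (P : ℤ) - 1 then (1 : ℝ) else 0) *
                  ∑' yw : Site (d + 1) × Site (d + 1), (if yw.1 α % NL = NL - 1 then (1 : ℝ) else 0) * (if yw.2 β % NL = NL - 1 then (1 : ℝ) else 0) *
                    dM (K2OfK (unitK sf sm (coDressKBmAt (toSite r) Lc (KInvStep (d := d) Lc j))) Lc S M μ (toSite r')) Lc S M ν u' yw.1 yw.2
                      (Sum.inl α) (Sum.inl β)))) := by
      intro r'
      have hpt : ∀ u' : Site (d + 1),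
          (if toSite r' μ % (P : ℤ) = (P : ℤ) - 1 then (1 : ℝ) else 0) * (if u' ν % (P : ℤ) = (P : ℤ) - 1 then (1 : ℝ) else 0) *
            ∑' yw : Site (d + 1) × Site (d + 1), (if yw.1 α % NL = NL - 1 then (1 : ℝ) else 0) * (if yw.2 β % NL = NL - 1 then (1 : ℝ) else 0) *
              W2SymOfK (unitK sf sm (coDressKBmAt (toSite r) Lc (KInvStep (d := d) Lc j))) Lc S M 0 M₂ μ (toSite r') ν u' yw.1 yw.2
                (Sum.inl α) (Sum.inl β)
          = (if toSite r' μ % (P : ℤ) = (P : ℤ) - 1 then (1 : ℝ) else 0) *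
            (((if u' ν % (P : ℤ) = (P : ℤ) - 1 then (1 : ℝ) else 0) *
                ∑' yw : Site (d + 1) × Site (d + 1), (if yw.1 α % NL = NL - 1 then (1 : ℝ) else 0) * (if yw.2 β % NL = NL - 1 then (1 : ℝ) else 0) *
                  mixOfK (unitK sf sm (coDressKBmAt (toSite r) Lc (KInvStep (d := d) Lc j))) Lc M₂ μ (toSite r') ν u' yw.1 yw.2 (Sum.inl α) (Sum.inl β)
             + (if u' ν % (P : ℤ) = (P : ℤ) - 1 then (1 : ℝ) else 0) *
                ∑' yw : Site (d + 1) × Site (d + 1), (if yw.1 α % NL = NL - 1 then (1 : ℝ) else 0) * (if yw.2 β % NL = NL - 1 then (1 : ℝ) else 0) *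
                  mixOfK (unitK sf sm (coDressKBmAt (toSite r) Lc (KInvStep (d := d) Lc j))) Lc M₂ ν u' μ (toSite r') yw.1 yw.2 (Sum.inl α) (Sum.inl β))
             + (1 / 2 : ℝ) * ((if u' ν % (P : ℤ) = (P : ℤ) - 1 then (1 : ℝ) else 0) *
                  ∑' yw : Site (d + 1) × Site (d + 1), (if yw.1 α % NL = NL - 1 then (1 : ℝ) else 0) * (if yw.2 β % NL = NL - 1 then (1 : ℝ) else 0) *
                    dM (K2OfK (unitK sf sm (coDressKBmAt (toSite r) Lc (KInvStep (d := d) Lc j))) Lc S M ν u') Lc S M μ (toSite r') yw.1 yw.2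
                      (Sum.inl α) (Sum.inl β)
               + (if u' ν % (P : ℤ) = (P : ℤ) - 1 then (1 : ℝ) else 0) *
                  ∑' yw : Site (d + 1) × Site (d + 1), (if yw.1 α % NL = NL - 1 then (1 : ℝ) else 0) * (if yw.2 β % NL = NL - 1 then (1 : ℝ) else 0) *
                    dM (K2OfK (unitK sf sm (coDressKBmAt (toSite r) Lc (KInvStep (d := d) Lc j))) Lc S M μ (toSite r')) Lc S M ν u' yw.1 yw.2
                      (Sum.inl α) (Sum.inl β))) := by
        intro u'
        rw [tsum_facePair_W2SymOfK_zero₂ (N := Lc) hKm hCK0 hm0 hSm hMm hM₂m μ (toSite r') ν u' NL α β (Sum.inl α) (Sum.inl β)]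
        ring
      simp only [hpt]
      rw [tsum_mul_left, ((s1 r').add (s2 r')).tsum_add (((s3 r').add (s4 r')).mul_left _), (s1 r').tsum_add (s2 r'), tsum_mul_left,
        (s3 r').tsum_add (s4 r')]
    simp only [hsplit]
    -- the first mixed face word vanishes bond by bond, the second after the sum over the cell
    have hmix1 : ∀ r' : Fin (d + 1) → ℕ, (∑' u' : Site (d + 1), (if u' ν % (P : ℤ) = (P : ℤ) - 1 then (1 : ℝ) else 0) *
        ∑' yw : Site (d + 1) × Site (d + 1), (if yw.1 α % NL = NL - 1 then (1 : ℝ) else 0) * (if yw.2 β % NL = NL - 1 then (1 : ℝ) else 0) *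
          mixOfK (unitK sf sm (coDressKBmAt (toSite r) Lc (KInvStep (d := d) Lc j))) Lc M₂ μ (toSite r') ν u' yw.1 yw.2 (Sum.inl α) (Sum.inl β)) = 0 := by
      intro r'
      have h := tsum_faceBond_mixWord_eq_zero (d := d) hLc hr sf sm j hM₂ hδ₂ μ (toSite r') ν
        (fun s : ℤ => if s % (P : ℤ) = (P : ℤ) - 1 then (1 : ℝ) else 0) hχ
        (fun yw : Site (d + 1) × Site (d + 1) => (if yw.1 α % NL = NL - 1 then (1 : ℝ) else 0) * (if yw.2 β % NL = NL - 1 then (1 : ℝ) else 0))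
        (hmb α β) (Sum.inl α) (Sum.inl β)
      simpa only [mul_assoc] using h
    have hmix2 := sum_box_tsum_mixWord_swap_eq_zero (d := d) hLc hr sf sm j (P := P) hM₂ hδ₂ hM₂t μ ν
      (fun s : ℤ => if s % (P : ℤ) = (P : ℤ) - 1 then (1 : ℝ) else 0) (fun s : ℤ => if s % (P : ℤ) = (P : ℤ) - 1 then (1 : ℝ) else 0) hχ hχ
      (hχP μ) (hχP ν)
      (fun yw : Site (d + 1) × Site (d + 1) => (if yw.1 α % NL = NL - 1 then (1 : ℝ) else 0) * (if yw.2 β % NL = NL - 1 then (1 : ℝ) else 0))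
      (hmb α β) (hmN α β) (Sum.inl α) (Sum.inl β)
    simp only [hmix1, zero_add]
    have hmix2' : ∑ r' ∈ box (d + 1) P, (if toSite r' μ % (P : ℤ) = (P : ℤ) - 1 then (1 : ℝ) else 0) *
        (∑' u' : Site (d + 1), (if u' ν % (P : ℤ) = (P : ℤ) - 1 then (1 : ℝ) else 0) *
          ∑' yw : Site (d + 1) × Site (d + 1), (if yw.1 α % NL = NL - 1 then (1 : ℝ) else 0) * (if yw.2 β % NL = NL - 1 then (1 : ℝ) else 0) *
            mixOfK (unitK sf sm (coDressKBmAt (toSite r) Lc (KInvStep (d := d) Lc j))) Lc M₂ ν u' μ (toSite r') yw.1 yw.2 (Sum.inl α) (Sum.inl β)) = 0 := by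
      refine (Finset.sum_congr rfl fun r' _ => ?_).trans hmix2
      rw [← tsum_mul_left]
      refine tsum_congr fun u' => ?_
      simp only [mul_assoc]
    rw [Finset.mul_sum]
    have e : ∀ r' : Fin (d + 1) → ℕ, (if toSite r' μ % (P : ℤ) = (P : ℤ) - 1 then (1 : ℝ) else 0) *
        ((∑' u' : Site (d + 1), (if u' ν % (P : ℤ) = (P : ℤ) - 1 then (1 : ℝ) else 0) *
            ∑' yw : Site (d + 1) × Site (d + 1), (if yw.1 α % NL = NL - 1 then (1 : ℝ) else 0) * (if yw.2 β % NL = NL - 1 then (1 : ℝ) else 0) *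
              mixOfK (unitK sf sm (coDressKBmAt (toSite r) Lc (KInvStep (d := d) Lc j))) Lc M₂ ν u' μ (toSite r') yw.1 yw.2 (Sum.inl α) (Sum.inl β))
          + (1 / 2 : ℝ) * ((∑' u' : Site (d + 1), (if u' ν % (P : ℤ) = (P : ℤ) - 1 then (1 : ℝ) else 0) *
                ∑' yw : Site (d + 1) × Site (d + 1), (if yw.1 α % NL = NL - 1 then (1 : ℝ) else 0) * (if yw.2 β % NL = NL - 1 then (1 : ℝ) else 0) *
                  dM (K2OfK (unitK sf sm (coDressKBmAt (toSite r) Lc (KInvStep (d := d) Lc j))) Lc S M ν u') Lc S M μ (toSite r') yw.1 yw.2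
                    (Sum.inl α) (Sum.inl β))
             + (∑' u' : Site (d + 1), (if u' ν % (P : ℤ) = (P : ℤ) - 1 then (1 : ℝ) else 0) *
                ∑' yw : Site (d + 1) × Site (d + 1), (if yw.1 α % NL = NL - 1 then (1 : ℝ) else 0) * (if yw.2 β % NL = NL - 1 then (1 : ℝ) else 0) *
                  dM (K2OfK (unitK sf sm (coDressKBmAt (toSite r) Lc (KInvStep (d := d) Lc j))) Lc S M μ (toSite r')) Lc S M ν u' yw.1 yw.2
                    (Sum.inl α) (Sum.inl β))))
        = (if toSite r' μ % (P : ℤ) = (P : ℤ) - 1 then (1 : ℝ) else 0) *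
            (∑' u' : Site (d + 1), (if u' ν % (P : ℤ) = (P : ℤ) - 1 then (1 : ℝ) else 0) *
              ∑' yw : Site (d + 1) × Site (d + 1), (if yw.1 α % NL = NL - 1 then (1 : ℝ) else 0) * (if yw.2 β % NL = NL - 1 then (1 : ℝ) else 0) *
                mixOfK (unitK sf sm (coDressKBmAt (toSite r) Lc (KInvStep (d := d) Lc j))) Lc M₂ ν u' μ (toSite r') yw.1 yw.2 (Sum.inl α) (Sum.inl β))
          + (1 / 2 : ℝ) * ∑' u' : Site (d + 1), (if toSite r' μ % (P : ℤ) = (P : ℤ) - 1 then (1 : ℝ) else 0) * (if u' ν % (P : ℤ) = (P : ℤ) - 1 then (1 : ℝ) else 0) *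
            ((∑' yw : Site (d + 1) × Site (d + 1), (if yw.1 α % NL = NL - 1 then (1 : ℝ) else 0) * (if yw.2 β % NL = NL - 1 then (1 : ℝ) else 0) *
                dM (K2OfK (unitK sf sm (coDressKBmAt (toSite r) Lc (KInvStep (d := d) Lc j))) Lc S M ν u') Lc S M μ (toSite r') yw.1 yw.2
                  (Sum.inl α) (Sum.inl β))
             + (∑' yw : Site (d + 1) × Site (d + 1), (if yw.1 α % NL = NL - 1 then (1 : ℝ) else 0) * (if yw.2 β % NL = NL - 1 then (1 : ℝ) else 0) *
                dM (K2OfK (unitK sf sm (coDressKBmAt (toSite r) Lc (KInvStep (d := d) Lc j))) Lc S M μ (toSite r')) Lc S M ν u' yw.1 yw.2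
                  (Sum.inl α) (Sum.inl β))) := by
      intro r'
      have h3 : (∑' u' : Site (d + 1), (if toSite r' μ % (P : ℤ) = (P : ℤ) - 1 then (1 : ℝ) else 0) * (if u' ν % (P : ℤ) = (P : ℤ) - 1 then (1 : ℝ) else 0) *
            ((∑' yw : Site (d + 1) × Site (d + 1), (if yw.1 α % NL = NL - 1 then (1 : ℝ) else 0) * (if yw.2 β % NL = NL - 1 then (1 : ℝ) else 0) *
                dM (K2OfK (unitK sf sm (coDressKBmAt (toSite r) Lc (KInvStep (d := d) Lc j))) Lc S M ν u') Lc S M μ (toSite r') yw.1 yw.2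
                  (Sum.inl α) (Sum.inl β))
             + (∑' yw : Site (d + 1) × Site (d + 1), (if yw.1 α % NL = NL - 1 then (1 : ℝ) else 0) * (if yw.2 β % NL = NL - 1 then (1 : ℝ) else 0) *
                dM (K2OfK (unitK sf sm (coDressKBmAt (toSite r) Lc (KInvStep (d := d) Lc j))) Lc S M μ (toSite r')) Lc S M ν u' yw.1 yw.2
                  (Sum.inl α) (Sum.inl β))))
          = (if toSite r' μ % (P : ℤ) = (P : ℤ) - 1 then (1 : ℝ) else 0) *
            ((∑' u' : Site (d + 1), (if u' ν % (P : ℤ) = (P : ℤ) - 1 then (1 : ℝ) else 0) *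
                  ∑' yw : Site (d + 1) × Site (d + 1), (if yw.1 α % NL = NL - 1 then (1 : ℝ) else 0) * (if yw.2 β % NL = NL - 1 then (1 : ℝ) else 0) *
                    dM (K2OfK (unitK sf sm (coDressKBmAt (toSite r) Lc (KInvStep (d := d) Lc j))) Lc S M ν u') Lc S M μ (toSite r') yw.1 yw.2
                      (Sum.inl α) (Sum.inl β))
               + (∑' u' : Site (d + 1), (if u' ν % (P : ℤ) = (P : ℤ) - 1 then (1 : ℝ) else 0) *
                  ∑' yw : Site (d + 1) × Site (d + 1), (if yw.1 α % NL = NL - 1 then (1 : ℝ) else 0) * (if yw.2 β % NL = NL - 1 then (1 : ℝ) else 0) *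
                    dM (K2OfK (unitK sf sm (coDressKBmAt (toSite r) Lc (KInvStep (d := d) Lc j))) Lc S M μ (toSite r')) Lc S M ν u' yw.1 yw.2
                      (Sum.inl α) (Sum.inl β))) := by
        rw [← (s3 r').tsum_add (s4 r'), ← tsum_mul_left]
        refine tsum_congr fun u' => ?_
        ring
      rw [h3]
      ring
    simp only [e, Finset.sum_add_distrib, hmix2', zero_add]
  -- the response words are odd under the exchange of the two legs
  have hR : ∀ μ ν α β : Fin (d + 1),
      (∑ r' ∈ box (d + 1) P, ∑' u' : Site (d + 1),
          (if toSite r' μ % (P : ℤ) = (P : ℤ) - 1 then (1 : ℝ) else 0) * (if u' ν % (P : ℤ) = (P : ℤ) - 1 then (1 : ℝ) else 0) *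
            ((∑' yw : Site (d + 1) × Site (d + 1), (if yw.1 β % NL = NL - 1 then (1 : ℝ) else 0) * (if yw.2 α % NL = NL - 1 then (1 : ℝ) else 0) *
                dM (K2OfK (unitK sf sm (coDressKBmAt (toSite r) Lc (KInvStep (d := d) Lc j))) Lc S M ν u') Lc S M μ (toSite r') yw.1 yw.2
                  (Sum.inl β) (Sum.inl α))
             + (∑' yw : Site (d + 1) × Site (d + 1), (if yw.1 β % NL = NL - 1 then (1 : ℝ) else 0) * (if yw.2 α % NL = NL - 1 then (1 : ℝ) else 0) *
                dM (K2OfK (unitK sf sm (coDressKBmAt (toSite r) Lc (KInvStep (d := d) Lc j))) Lc S M μ (toSite r')) Lc S M ν u' yw.1 yw.2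
                  (Sum.inl β) (Sum.inl α))))
        = -(∑ r' ∈ box (d + 1) P, ∑' u' : Site (d + 1),
          (if toSite r' μ % (P : ℤ) = (P : ℤ) - 1 then (1 : ℝ) else 0) * (if u' ν % (P : ℤ) = (P : ℤ) - 1 then (1 : ℝ) else 0) *
            ((∑' yw : Site (d + 1) × Site (d + 1), (if yw.1 α % NL = NL - 1 then (1 : ℝ) else 0) * (if yw.2 β % NL = NL - 1 then (1 : ℝ) else 0) *
                dM (K2OfK (unitK sf sm (coDressKBmAt (toSite r) Lc (KInvStep (d := d) Lc j))) Lc S M ν u') Lc S M μ (toSite r') yw.1 yw.2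
                  (Sum.inl α) (Sum.inl β))
             + (∑' yw : Site (d + 1) × Site (d + 1), (if yw.1 α % NL = NL - 1 then (1 : ℝ) else 0) * (if yw.2 β % NL = NL - 1 then (1 : ℝ) else 0) *
                dM (K2OfK (unitK sf sm (coDressKBmAt (toSite r) Lc (KInvStep (d := d) Lc j))) Lc S M μ (toSite r')) Lc S M ν u' yw.1 yw.2
                  (Sum.inl α) (Sum.inl β)))) := by
    intro μ ν α β
    rw [← Finset.sum_neg_distrib]
    refine Finset.sum_congr rfl fun r' _ => ?_
    rw [← tsum_neg]
    refine tsum_congr fun u' => ?_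
    rw [resp_facePair_swap NL _ Lc hSrow hMrow μ (toSite r') α β, resp_facePair_swap NL _ Lc hSrow hMrow ν u' α β]
    ring
  intro κ κ' κ₁ κ₂
  simp only [hWw]
  rw [hR κ κ' κ₁ κ₂, hR κ' κ κ₁ κ₂]
  ring

end Dressed

end Summit.QuantumFields.BalabanUV.Beta.GAN24.FaceWWordVanishing

end
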